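import Summits.SmoothPoincare4.SmoothPoincare4.Theorems.ConvexBisectionAcyclicBisectionExistsDualDataHandle
import Summits.SmoothPoincare4.SmoothPoincare4.Theorems.ConvexBisectionAcyclicBisectionExistsPushedPrefixPush
import HarnessLib

/-!
# The dual multi-attachment data, IV: the stretched `W`-piece is a topological embedding
(helper file 4 of the wave-5 brick T3b (iv) "the dual multi-attachment data `D₂` on the complement
piece `W₂`" for stub `stub_T3_dualPresentation` (T3), line `modp-braid-orbits`, crux
`ConvexBisection.AcyclicBisectionExists`, item stmt-SmoothPoincare4-10508; lead c5, worker X1)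

Sequel of `…DualDataHandle.lean`, independent of `…DualDataExtension.lean` (the stretch `E` enters through
its two defining clauses, its continuity and its injectivity off the attaching circles).  The source
`W ∖ ⋃ⱼ (circles)` of `E` is not compact and `E` is not an open map into `M'`, so the embedding property
is proved by a compactness argument on the exhaustion by the closed sets
`L_c = {w | every tube coordinate y of w has ‖y_λ‖² ≤ c}` (`c < 1`):

* §1 a general criterion (`isEmbedding_of_forall_compact`): a continuous injection into a Hausdorff space
  is an embedding as soon as every point has a compact neighbourhood `L` whose outside is mapped away
  from the image of the point (`F a ∉ closure (F '' Lᶜ)`);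
* §2 the sets `L_c` are closed (the attaching maps are open maps) and lie off the circles, the deep sets
  `{∃ tube coordinate with c ≤ ‖y_λ‖²}` are closed;
* §3 the compact catcher `C_c = ⋃ⱼ Θⱼ (𝓕 {‖u‖ ≤ 1, ‖u_λ‖² ≤ 1 - c})` of the images of the deep tube ends,
  and **`isEmbedding_extension`**: `E` restricted to `W ∖ ⋃ⱼ (circles)` is a topological embedding.

Everything here is proved; no named facts, no definitions.

## References
* J. Milnor, *Lectures on the h-cobordism theorem* (1965), §3. [MilnorHCobordism1965]
* A. A. Kosinski, *Differential Manifolds* (1993), VI §6. [Kosinski1993]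
* J. M. Lee, *Introduction to Smooth Manifolds* (2013), Lemma A.57 (closed map lemma). [LeeSmoothManifolds2013]
-/

noncomputable section

-- the prescribed namespace `Summit.<P>.<Sub>.…` duplicates `SmoothPoincare4` (P = Sub)
set_option linter.dupNamespace false

open scoped Manifold ContDiff Topology

namespace Summit.SmoothPoincare4.SmoothPoincare4.Theorems.AcyclicBisectionExists.ModpBraidOrbits

open Set Function Metric Filter Topology
open Literature.Topology.FourManifolds Literature.Topology.FourManifolds.HandleAttachingMap

/-! ### §1 A criterion for embeddings -/

section Criterion

/-- **A continuous injection into a Hausdorff space which is "proper near every point" is an embedding**: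
if every `a` has a compact neighbourhood `L` with `F a ∉ closure (F '' Lᶜ)`, then `F` is a topological
embedding.  (Given a neighbourhood `U ⊆ L` of `a`, the compact `F (L ∖ U)` and `closure (F Lᶜ)` are closed
and miss `F a`; their common complement pulls back into `U`.) [folklore] -/
theorem isEmbedding_of_forall_compact {A Y : Type*} [TopologicalSpace A] [TopologicalSpace Y] [T2Space Y]
    {F : A → Y} (hc : Continuous F) (hinj : Injective F)
    (hL : ∀ a : A, ∃ L : Set A, IsCompact L ∧ L ∈ 𝓝 a ∧ F a ∉ closure (F '' Lᶜ)) : IsEmbedding F := by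
  refine ⟨isInducing_iff_nhds.2 fun a => le_antisymm ?_ ?_, hinj⟩
  · exact Filter.map_le_iff_le_comap.1 hc.continuousAt
  · intro U hU
    obtain ⟨L, hLc, hLa, hcl⟩ := hL a
    obtain ⟨U', hU'U, hU'o, haU'⟩ := mem_nhds_iff.1 (inter_mem hU hLa)
    have hK : IsCompact (L \ U') := hLc.diff hU'o
    have hKc : IsClosed (F '' (L \ U')) := (hK.image hc).isClosed
    have ha1 : F a ∉ F '' (L \ U') := by
      rintro ⟨x, hx, he⟩
      rw [hinj he] at hx
      exact hx.2 haU'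
    refine Filter.mem_comap.2 ⟨(F '' (L \ U'))ᶜ ∩ (closure (F '' Lᶜ))ᶜ,
      inter_mem (hKc.isOpen_compl.mem_nhds ha1) (isClosed_closure.isOpen_compl.mem_nhds hcl), fun x hx => ?_⟩
    by_cases hxL : x ∈ L
    · by_contra hxU
      have hxU' : x ∉ U' := fun h' => hxU (hU'U h').1
      exact hx.1 ⟨x, ⟨hxL, hxU'⟩, rfl⟩
    · exact absurd (subset_closure (mem_image_of_mem F (show x ∈ Lᶜ from hxL))) hx.2

end Criterion

/-! ### §2 The closed sets `L_c` and the deep ends of the tubes -/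

section Tubes

variable {W : Type} [TopologicalSpace W] [ChartedSpace (EuclideanHalfSpace 4) W]
  {ι' : Type} (g : ι' → HandleAttachingMap 3 2 W)

/-- An attaching map is an open map (a topological embedding with open range). [cite: Kosinski1993, VI §6] -/
theorem isOpenMap_attachingMap (q : HandleAttachingMap 3 2 W) : IsOpenMap q.toFun :=
  (⟨q.isSmoothEmbedding.isEmbedding, q.isOpen_range⟩ : IsOpenEmbedding q.toFun).isOpenMap

/-- **`L_c = {w | every tube coordinate of w has ‖y_λ‖² ≤ c}` is closed** (its complement is the union of
the open images `g j {c < ‖y_λ‖²}`). [folklore] -/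
theorem isClosed_leSet (c : ℝ) :
    IsClosed {w : W | ∀ (j : ι') (y : ↥(handleTube 3 2)), (g j).toFun y = w →
      lamSq 2 (((y : closedBall (0 : EuclideanSpace ℝ (Fin 4)) 1) : EuclideanSpace ℝ (Fin 4))) ≤ c} := by
  have hop : IsOpen (⋃ j : ι', (g j).toFun '' {y : ↥(handleTube 3 2) |
      c < lamSq 2 (((y : closedBall (0 : EuclideanSpace ℝ (Fin 4)) 1) : EuclideanSpace ℝ (Fin 4)))}) :=
    isOpen_iUnion fun j => isOpenMap_attachingMap (g j) _ (isOpen_lt continuous_const (continuous_lamSq_handleTube 3 2))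
  rw [← isOpen_compl_iff]
  convert hop using 1
  ext w
  simp only [mem_compl_iff, mem_setOf_eq, mem_iUnion, mem_image, not_forall, not_le, exists_prop]
  constructor
  · rintro ⟨j, y, he, hy⟩
    exact ⟨j, y, hy, he⟩
  · rintro ⟨j, y, hy, he⟩
    exact ⟨j, y, he, hy⟩

/-- **The deep set `{w | some tube coordinate of w has c ≤ ‖y_λ‖²}` is closed** (`0 < c`: a finite union of
compact images). [folklore] -/
theorem isClosed_deepSet [Finite ι'] [T2Space W] {c : ℝ} (hc : 0 < c) :
    IsClosed {w : W | ∃ (j : ι') (y : ↥(handleTube 3 2)), (g j).toFun y = w ∧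
      c ≤ lamSq 2 (((y : closedBall (0 : EuclideanSpace ℝ (Fin 4)) 1) : EuclideanSpace ℝ (Fin 4)))} := by
  have hcl : IsClosed (⋃ j : ι', (g j).toFun '' {y : ↥(handleTube 3 2) |
      c ≤ lamSq 2 (((y : closedBall (0 : EuclideanSpace ℝ (Fin 4)) 1) : EuclideanSpace ℝ (Fin 4)))}) :=
    isClosed_iUnion_of_finite fun j => (isCompact_image_tube_ge j hc).isClosed
  convert hcl using 1
  ext w
  simp only [mem_setOf_eq, mem_iUnion, mem_image]
  constructor
  · rintro ⟨j, y, he, hy⟩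
    exact ⟨j, y, hy, he⟩
  · rintro ⟨j, y, hy, he⟩
    exact ⟨j, y, he, hy⟩

/-- `L_c` lies off the attaching circles for `c < 1`. [folklore] -/
theorem leSet_subset_coresComplement [Finite ι'] [T2Space W] {c : ℝ} (hc1 : c < 1) :
    {w : W | ∀ (j : ι') (y : ↥(handleTube 3 2)), (g j).toFun y = w →
      lamSq 2 (((y : closedBall (0 : EuclideanSpace ℝ (Fin 4)) 1) : EuclideanSpace ℝ (Fin 4))) ≤ c} ⊆
      (coresComplement g : Set W) := by
  intro w hw
  rw [SetLike.mem_coe, mem_coresComplement]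
  intro j hj
  obtain ⟨y, hy, he⟩ := (mem_core_iff _).1 hj
  have := hw j y he
  linarith

end Tubes

/-! ### §3 The compact catcher of the deep tube ends; `E` is an embedding -/

section Embedding

variable {B : Type} [TopologicalSpace B] [T2Space B] [ChartedSpace (EuclideanHalfSpace 4) B]
  {ι : Type} [Finite ι] {h : ι → HandleAttachingMap 3 2 B}
  {X : Type} [TopologicalSpace X] [ChartedSpace (EuclideanHalfSpace 4) X] [IsManifold (𝓡∂ 4) ∞ X]
  (D : MultiAttachmentData h (𝓡∂ 4) X) {ι' : Type} (f : ι' → ι) {bX : BoundaryData (𝓡∂ 4) X (𝓡 3)}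
  {W : Type} [TopologicalSpace W] [ChartedSpace (EuclideanHalfSpace 4) W]
  [IsManifold (𝓡∂ 4) ∞ W] {bW : BoundaryData (𝓡∂ 4) W (𝓡 3)} [Nonempty bX.carrier]
  (G : BoundaryGlueData bX bW) {a κ δ : ℝ} (g : ι' → HandleAttachingMap 3 2 W)

/-- **The model map takes the dual cocore disc `{u_λ = 0}` into the open unit ball**:
`𝓕 u = √(κ²/8) · (u_μ, 0)` there, of norm `≤ √(κ²/8) < 1`. [cite: MilnorHCobordism1965, §3] -/
theorem norm_modelF_lt_one_of_sOf_eq_zero (hκ : 0 < κ) (hκ2 : κ ≤ 1 / 2) {u : EuclideanSpace ℝ (Fin 4)}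
    (hu : ‖u‖ ≤ 1) (h0 : sOf u = 0) : ‖modelF a κ δ u‖ < 1 := by
  have hl : lamPart u = 0 := by
    have : ‖lamPart u‖ ^ 2 = 0 := h0
    rwa [sq_eq_zero_iff, norm_eq_zero] at this
  have hp : pFun κ 0 = κ ^ 2 / 8 := by
    unfold pFun coreCut
    rw [mul_zero, Real.smoothTransition.zero_of_nonpos le_rfl]; ring
  have hmu0 : muEmbed (lamPart u) = 0 := by rw [hl, ← norm_eq_zero, norm_muEmbed, norm_zero]
  have h1 : modelF a κ δ u = Real.sqrt (κ ^ 2 / 8) • lamEmbed (muPart u) := by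
    rw [modelF, hmu0, smul_zero, add_zero, h0, sub_zero, div_one, hp]
  rw [h1, norm_smul, Real.norm_of_nonneg (Real.sqrt_nonneg _), norm_lamEmbed]
  have hs : Real.sqrt (κ ^ 2 / 8) ≤ 1 / 2 :=
    calc Real.sqrt (κ ^ 2 / 8) ≤ Real.sqrt ((1 / 2) ^ 2) := Real.sqrt_le_sqrt (by nlinarith)
      _ = 1 / 2 := Real.sqrt_sq (by norm_num)
  have hm : ‖muPart u‖ ≤ 1 := (norm_muPart_le u).trans hu
  nlinarith [norm_nonneg (muPart u), Real.sqrt_nonneg (κ ^ 2 / 8)]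

variable [CompactSpace X] [T2Space X] [T2Space W]

/-- **The catcher `C_c = ⋃ⱼ Θⱼ (𝓕 {‖u‖ ≤ 1, ‖u_λ‖² ≤ 1 - c})` is compact** (`0 < c`; continuous images of a
compact subset of the domain of `Θ ∘ 𝓕`). [folklore] -/
theorem isCompact_catcher [Finite ι'] (ha : 0 < a) (hCM : ∀ j, CollarAdapted D (f j) G a) (hκ : 0 < κ)
    (hκ2 : κ ≤ 1 / 2) (hδ : 0 < δ) (hδ2 : δ ≤ 1 / 2) (haδ : a * δ ≤ 1 / 5) {c : ℝ} (hc : 0 < c) :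
    IsCompact (⋃ j : ι', (fun u => gluedHandleChart D (f j) G a (modelF a κ δ u)) ''
      {u : EuclideanSpace ℝ (Fin 4) | ‖u‖ ≤ 1 ∧ sOf u ≤ 1 - c}) := by
  have hZ : IsCompact {u : EuclideanSpace ℝ (Fin 4) | ‖u‖ ≤ 1 ∧ sOf u ≤ 1 - c} := by
    have heq : {u : EuclideanSpace ℝ (Fin 4) | ‖u‖ ≤ 1 ∧ sOf u ≤ 1 - c} =
        closedBall (0 : EuclideanSpace ℝ (Fin 4)) 1 ∩ {u | sOf u ≤ 1 - c} := by
      ext u; simp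
    rw [heq]
    exact (isCompact_closedBall _ _).inter_right (isClosed_le contDiff_sOf.continuous continuous_const)
  refine isCompact_iUnion fun j => hZ.image_of_continuousOn
    ((contMDiffOn_comp_modelF D (f j) G ha (hCM j) hκ hκ2 hδ hδ2).continuousOn.mono fun u hu => ?_)
  exact mem_compDom_of_norm_le_one ha hκ hκ2 hδ hδ2 haδ hu.1 (by linarith [hu.2])

/-- **THE STRETCHED `W`-PIECE IS A TOPOLOGICAL EMBEDDING off the attaching circles.**  For a map
`E : W → M'` which is `Θ_{f j} ∘ 𝓕 ∘ α` on the tubes of a finite family `g` of attaching maps with disjoint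
ranges (off their attaching spheres) and `j_N` off the tubes, continuous and injective on
`W ∖ ⋃ⱼ (circles)`, the restriction to `W ∖ ⋃ⱼ (circles)` is an embedding: apply
`isEmbedding_of_forall_compact` with the compact neighbourhoods `L_c` (`c < 1` above the tube level of the
point); the outside of `L_c` is mapped into the compact catcher `C_c`, which misses the image of the
point (deep images are images of deep tube points or interior handle points of `X`, and `E` is
injective). [cite: MilnorHCobordism1965, §3] -/
theorem isEmbedding_extension [Finite ι'] [CompactSpace W] (ha : 0 < a) (hf : Injective f)
    (hCM : ∀ j, CollarAdapted D (f j) G a) (hκ : 0 < κ) (hκ2 : κ ≤ 1 / 2) (hδ : 0 < δ) (hδ2 : δ ≤ 1 / 2)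
    (haδ : a * δ ≤ 1 / 5) (hdisj : Pairwise fun i j => Disjoint (range (g i).toFun) (range (g j).toFun))
    {E : W → G.d₂.Glued}
    (hE1 : ∀ w, (∀ (j : ι') (y : ↥(handleTube 3 2)), (g j).toFun y ≠ w) → E w = G.jN w)
    (hE2 : ∀ (j : ι') (y : ↥(handleTube 3 2)),
      lamSq 2 (((y : closedBall (0 : EuclideanSpace ℝ (Fin 4)) 1) : EuclideanSpace ℝ (Fin 4))) ≠ 1 →
      E ((g j).toFun y) = gluedHandleChart D (f j) G a (modelF a κ δ
        (handleInversion 2 (((y : closedBall (0 : EuclideanSpace ℝ (Fin 4)) 1) : EuclideanSpace ℝ (Fin 4))))))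
    (hcont : Continuous fun w : ↥(coresComplement g) => E w) (hinj : InjOn E (coresComplement g : Set W)) :
    IsEmbedding fun w : ↥(coresComplement g) => E w := by
  -- the catcher misses the image of every point above level `c`
  have hnot : ∀ {c : ℝ}, 0 < c → ∀ w : W, w ∈ coresComplement g →
      (∀ (j : ι') (y : ↥(handleTube 3 2)), (g j).toFun y = w →
        lamSq 2 (((y : closedBall (0 : EuclideanSpace ℝ (Fin 4)) 1) : EuclideanSpace ℝ (Fin 4))) < c) →
      E w ∉ ⋃ j : ι', (fun u => gluedHandleChart D (f j) G a (modelF a κ δ u)) ''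
        {u : EuclideanSpace ℝ (Fin 4) | ‖u‖ ≤ 1 ∧ sOf u ≤ 1 - c} := by
    intro c hc w hwA hwc hmem
    rw [mem_iUnion] at hmem
    obtain ⟨j, u, ⟨hu1, hus⟩, heq⟩ := hmem
    change gluedHandleChart D (f j) G a (modelF a κ δ u) = E w at heq
    have hus1 : sOf u < 1 := by linarith
    have hV := mem_compDom_of_norm_le_one ha hκ hκ2 hδ hδ2 haδ hu1 hus1
    rcases (sq_nonneg ‖lamPart u‖ : 0 ≤ sOf u).eq_or_lt with h0 | hpos
    · -- `u` on the dual cocore disc: `Θ (𝓕 u)` is an interior handle point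
      have hn1 := norm_modelF_lt_one_of_sOf_eq_zero (a := a) (δ := δ) hκ hκ2 hu1 h0.symm
      by_cases hex : ∃ (j' : ι') (y' : ↥(handleTube 3 2)), (g j').toFun y' = w
      · obtain ⟨j', y', rfl⟩ := hex
        have hy' := (apply_mem_coresComplement_iff hdisj j' y').1 hwA
        rw [hE2 j' y' hy'] at heq
        obtain ⟨hx1, hxs, h0', hl1'⟩ := tube_inv_mem y' hy'
        have hus' : sOf (handleInversion 2 (((y' : closedBall (0 : EuclideanSpace ℝ (Fin 4)) 1) : EuclideanSpace ℝ (Fin 4)))) < 1 := by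
          rw [sOf_eq_lamSq, hxs]; linarith
        have hV' := mem_compDom_of_norm_le_one ha hκ hκ2 hδ hδ2 haδ hx1 hus'
        have hjj : f j = f j' := by
          by_contra hne
          exact gluedHandleChart_ne D G ha hne (hCM j) (hCM j') hV.2 hV'.2 heq
        have hjj' : j = j' := hf hjj
        subst hjj'
        have hαu := injOn_comp_modelF D (f j) G ha (hCM j) hκ hκ2 hδ hδ2 hV hV' heq
        have : sOf (handleInversion 2 (((y' : closedBall (0 : EuclideanSpace ℝ (Fin 4)) 1) : EuclideanSpace ℝ (Fin 4)))) = 0 := by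
          rw [← hαu]; exact h0.symm
        rw [sOf_eq_lamSq, hxs] at this
        exact absurd (by linarith : lamSq 2 (((y' : closedBall (0 : EuclideanSpace ℝ (Fin 4)) 1) : EuclideanSpace ℝ (Fin 4))) = 1) hy'
      · push Not at hex
        rw [hE1 w hex, gluedHandleChart_of_norm_lt_one D (f j) G a hn1] at heq
        obtain ⟨z, hz, -⟩ := G.jM_eq_jN_iff.1 heq
        have hint := isInteriorPoint_jB D (f j) (b := beltBallPt (modelF a κ δ u)) (by rwa [coe_beltBallPt hn1])
        rw [hz] at hint
        exact ((𝓡∂ 4).isInteriorPoint_iff_not_isBoundaryPoint _).1 hint (bX.incl_mem_boundary z)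
    · -- `0 < ‖u_λ‖²`: `u = α y''` for a deep tube point `y''`, and `E (g j y'') = E w`
      have hl0 : 0 < lamSq 2 u := by rwa [← sOf_eq_lamSq]
      have hl1 : lamSq 2 u < 1 := by rwa [← sOf_eq_lamSq]
      have hα1 : ‖handleInversion 2 u‖ ≤ 1 := norm_handleInversion_le_one hu1 hl0 hl1
      have hαl : lamSq 2 (handleInversion 2 u) = 1 - lamSq 2 u := lamSq_handleInversion hl0 hl1.le
      set y'' : ↥(handleTube 3 2) := ⟨⟨handleInversion 2 u, mem_closedBall_zero_iff.2 hα1⟩, by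
        rw [mem_handleTube]
        show lamSq 2 (handleInversion 2 u) ≠ 0
        rw [hαl]; linarith⟩ with hy''
      have hy''v : (((y'' : closedBall (0 : EuclideanSpace ℝ (Fin 4)) 1) : EuclideanSpace ℝ (Fin 4))) = handleInversion 2 u := rfl
      have hy''1 : lamSq 2 (((y'' : closedBall (0 : EuclideanSpace ℝ (Fin 4)) 1) : EuclideanSpace ℝ (Fin 4))) ≠ 1 := by
        rw [hy''v, hαl]; linarith
      have hEy : E ((g j).toFun y'') = gluedHandleChart D (f j) G a (modelF a κ δ u) := by
        rw [hE2 j y'' hy''1, hy''v, handleInversion_handleInversion hl0 hl1]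
      have hga : (g j).toFun y'' = w :=
        hinj ((apply_mem_coresComplement_iff hdisj j y'').2 hy''1) hwA (hEy.trans heq)
      have := hwc j y'' hga
      rw [hy''v, hαl, ← sOf_eq_lamSq] at this
      linarith
  -- the criterion
  refine isEmbedding_of_forall_compact hcont (fun x y hxy => Subtype.ext (hinj x.2 y.2 hxy)) fun p => ?_
  -- a level `c < 1` above the tube level of `p`
  obtain ⟨c, hc0, hc1, hpc⟩ : ∃ c : ℝ, 0 < c ∧ c < 1 ∧ ∀ (j : ι') (y : ↥(handleTube 3 2)), (g j).toFun y = (p : W) →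
      lamSq 2 (((y : closedBall (0 : EuclideanSpace ℝ (Fin 4)) 1) : EuclideanSpace ℝ (Fin 4))) < c := by
    by_cases hex : ∃ (j : ι') (y : ↥(handleTube 3 2)), (g j).toFun y = (p : W)
    · obtain ⟨j, y₀, hy₀⟩ := hex
      have hl1 : lamSq 2 (((y₀ : closedBall (0 : EuclideanSpace ℝ (Fin 4)) 1) : EuclideanSpace ℝ (Fin 4))) ≠ 1 :=
        (apply_mem_coresComplement_iff hdisj j y₀).1 (hy₀ ▸ p.2)
      have hl1' := lt_of_le_of_ne (lamSq_le_one (mem_closedBall_zero_iff.1 y₀.1.2)) hl1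
      refine ⟨(lamSq 2 (((y₀ : closedBall (0 : EuclideanSpace ℝ (Fin 4)) 1) : EuclideanSpace ℝ (Fin 4))) + 1) / 2,
        by linarith [lamSq_nonneg 2 (((y₀ : closedBall (0 : EuclideanSpace ℝ (Fin 4)) 1) : EuclideanSpace ℝ (Fin 4)))],
        by linarith, fun j' y' he => ?_⟩
      have hjj := index_eq_of_apply_eq hdisj (he.trans hy₀.symm)
      subst hjj
      have hyy : y' = y₀ := (g j').injective (he.trans hy₀.symm)
      subst hyy
      linarith
    · push Not at hex
      exact ⟨1 / 2, by norm_num, by norm_num, fun j y he => absurd he (hex j y)⟩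
  -- the compact neighbourhood `L_c`
  set Lc : Set W := {w : W | ∀ (j : ι') (y : ↥(handleTube 3 2)), (g j).toFun y = w →
      lamSq 2 (((y : closedBall (0 : EuclideanSpace ℝ (Fin 4)) 1) : EuclideanSpace ℝ (Fin 4))) ≤ c} with hLc
  have hLA : Lc ⊆ (coresComplement g : Set W) := leSet_subset_coresComplement g hc1
  refine ⟨Subtype.val ⁻¹' Lc, ?_, ?_, ?_⟩
  · rw [IsEmbedding.subtypeVal.isCompact_iff, image_preimage_eq_inter_range, Subtype.range_coe,
      inter_eq_left.2 hLA]
    exact (isClosed_leSet g c).isCompact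
  · have hopen : IsOpen {w : W | ∃ (j : ι') (y : ↥(handleTube 3 2)), (g j).toFun y = w ∧
        c ≤ lamSq 2 (((y : closedBall (0 : EuclideanSpace ℝ (Fin 4)) 1) : EuclideanSpace ℝ (Fin 4)))}ᶜ :=
      (isClosed_deepSet g hc0).isOpen_compl
    refine mem_of_superset ((hopen.preimage continuous_subtype_val).mem_nhds ?_) ?_
    · rintro ⟨j, y, he, hy⟩
      exact absurd (hpc j y he) (not_lt.2 hy)
    · intro q hq j y he
      by_contra hlt
      exact hq ⟨j, y, he, (not_le.1 hlt).le⟩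
  · intro hcl
    have hsub : (fun w : ↥(coresComplement g) => E w) '' (Subtype.val ⁻¹' Lc)ᶜ ⊆
        ⋃ j : ι', (fun u => gluedHandleChart D (f j) G a (modelF a κ δ u)) ''
          {u : EuclideanSpace ℝ (Fin 4) | ‖u‖ ≤ 1 ∧ sOf u ≤ 1 - c} := by
      rintro _ ⟨q, hq, rfl⟩
      have hq' : ¬ ∀ (j : ι') (y : ↥(handleTube 3 2)), (g j).toFun y = (q : W) →
          lamSq 2 (((y : closedBall (0 : EuclideanSpace ℝ (Fin 4)) 1) : EuclideanSpace ℝ (Fin 4))) ≤ c := hq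
      push Not at hq'
      obtain ⟨j, y, hyq, hcy⟩ := hq'
      have hy1 : lamSq 2 (((y : closedBall (0 : EuclideanSpace ℝ (Fin 4)) 1) : EuclideanSpace ℝ (Fin 4))) ≠ 1 :=
        (apply_mem_coresComplement_iff hdisj j y).1 (hyq ▸ q.2)
      obtain ⟨hx1, hxs, -, -⟩ := tube_inv_mem y hy1
      refine mem_iUnion.2 ⟨j, _, ⟨hx1, ?_⟩, ?_⟩
      · rw [sOf_eq_lamSq, hxs]; linarith
      · show gluedHandleChart D (f j) G a (modelF a κ δ _) = E (q : W)
        rw [← hyq, hE2 j y hy1]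
    have hmem := closure_minimal hsub (isCompact_catcher D f G ha hCM hκ hκ2 hδ hδ2 haδ hc0).isClosed hcl
    exact hnot hc0 p p.2 hpc hmem

end Embedding

/-- **Registered helper `helper_isEmbedding_of_forall_compact` (brick T3b (iv), sub-goal of
`stub_T3_dualPresentation`, wave 5, lead c5): a continuous injection into a Hausdorff space all of whose
points have a compact neighbourhood whose outside is mapped away from the image of the point is a
topological embedding** (the criterion by which the stretched `W`-piece `E` of the dual multi-attachment
data, whose source is not compact, is shown to be an embedding, `isEmbedding_extension`).
[folklore] -/
theorem helper_isEmbedding_of_forall_compact : ∀ {A Y : Type} [TopologicalSpace A] [TopologicalSpace Y] [T2Space Y] {F : A → Y}, Continuous F → Function.Injective F → (∀ a : A, ∃ L : Set A, IsCompact L ∧ L ∈ nhds a ∧ F a ∉ closure (F '' Lᶜ)) → Topology.IsEmbedding F :=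
  fun hc hinj hL => isEmbedding_of_forall_compact hc hinj hL

end Summit.SmoothPoincare4.SmoothPoincare4.Theorems.AcyclicBisectionExists.ModpBraidOrbits

end
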